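import Summits.QuantumFields.YangMills.Theorems.LuscherReductionTwistedTraceScalingBOStiffQuasimodeFrame
import Literature.Analysis.OperatorTheory.GaussianTransferKernel
import HarnessLib

/-!
# (B-ST) (W1-10 (A3)-model) `…BOStiffFlatTruncation`: Chernoff tails of the completed-square product Gaussian — the truncation of the flat quasimode integral to the profile ball costs
# a RELATIVE factor `2^{n/2}e^{−θr²/4} + 2^{d/2}e^{−r²/(8s²)}`
# (lane A of S-BASE, crux `TwistedTraceScaling` stmt-QuantumFields-20203, C4-CORE, the (B-ST) pen; (A) split (A3), for ✓`…BOStiffFlatQuasimode`)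

Pure real analysis in coordinates `(y, z) ∈ (ι → ℝ) × Z`:
* §1 `flatKernel_profile_eq_completed_sq` — per mode `e^{−ãx²}e^{−b̃(x−y)²}e^{−ãy²}e^{−cy²} = e^{−cx²}·e^{−s(y − (b̃/s)x)²}`, `s = ã+b̃+c` (✓Literature `gaussKernel_mul_groundState_eq` on `ℝ`);
  hence the whole stiff integrand is `e^{−Σcᵢxᵢ²}·Πᵢe^{−sᵢ(yᵢ−mᵢxᵢ)²}`, `mᵢ = b̃ᵢ/sᵢ ∈ [0,1]`;
* §2 ★ `integral_indicator_prodGauss_le` — CHERNOFF: for weights `wᵢ`, `θ > 0` with `θwᵢ ≤ sᵢ/2`: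
  `∫ 𝟙{Σwᵢuᵢ² > ρ}·Πᵢe^{−sᵢuᵢ²} du ≤ (√2)^{|ι|}·e^{−θρ}·Πᵢ√(π/sᵢ)` (exponential Markov + explicit Gaussian integrals);
* §3 ★ `integral_indicator_gauss_le` — gauge block: `∫ 𝟙{‖z‖² > ρ'}e^{−‖z‖²/s²} dz ≤ 2^{dim Z/2}·e^{−ρ'/(2s²)}·(πs²)^{dim Z/2}`.
The assembly (set `S ⊇ {Σwᵢyᵢ² + ‖z‖² ≤ r²}`, centre with `Σwᵢxᵢ² ≤ r²/8`: `∫_S ≥ (1 − tails)·∫`) is the next file, on the lead's flat coordinates.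
HONEST FRAMING: Gaussian algebra for a stub of a child of the CONDITIONAL route R2b1; (Q±) OPEN; (B-ST), C4-CORE OPEN; not infinite volume, not a gap, not Clay.
-/

set_option autoImplicit false

noncomputable section

open MeasureTheory Filter Topology Real
open scoped BigOperators

namespace Summit.QuantumFields.YangMills.Theorems.FemtoTransferGap.TwoLattice.ConstTube

open Literature.Analysis.OperatorTheory.GaussianTransferKernel

/-! ## §1 Completing the square per mode -/

/-- Per mode: `e^{−ax²}e^{−b(x−y)²}e^{−ay²}e^{−cy²} = e^{−cx²}·e^{−(a+b+c)(y − (b/(a+b+c))x)²}` (`c² = a²+2ab`, `a+b+c ≠ 0`). [cite: Wipf2021, §8.5.1 (8.56)] -/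
theorem flatKernel_profile_eq_completed_sq {a b c : ℝ} (hc : c ^ 2 = a ^ 2 + 2 * a * b) (hs : a + b + c ≠ 0) (x y : ℝ) :
    Real.exp (-(a * x ^ 2)) * Real.exp (-(b * (x - y) ^ 2)) * Real.exp (-(a * y ^ 2)) * Real.exp (-(c * y ^ 2)) =
      Real.exp (-(c * x ^ 2)) * Real.exp (-((a + b + c) * (y - b / (a + b + c) * x) ^ 2)) := by
  have h := gaussKernel_mul_groundState_eq (V := ℝ) hc hs x y
  simp only [Real.norm_eq_abs, sq_abs, smul_eq_mul] at h
  exact h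

/-- The product form: `Πᵢ[…] = e^{−Σcᵢxᵢ²}·Πᵢ e^{−sᵢ(yᵢ − mᵢxᵢ)²}`. [cite: Wipf2021, §8.5.1 (8.56)] -/
theorem flatKernel_profile_pi_eq {ι : Type*} [Fintype ι] {a b c : ι → ℝ} (hc : ∀ i, c i ^ 2 = a i ^ 2 + 2 * a i * b i) (hs : ∀ i, a i + b i + c i ≠ 0)
    (x y : ι → ℝ) :
    ∏ i, Real.exp (-(a i * x i ^ 2)) * Real.exp (-(b i * (x i - y i) ^ 2)) * Real.exp (-(a i * y i ^ 2)) * Real.exp (-(c i * y i ^ 2)) =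
      Real.exp (-(∑ i, c i * x i ^ 2)) * ∏ i, Real.exp (-((a i + b i + c i) * (y i - b i / (a i + b i + c i) * x i) ^ 2)) := by
  simp_rw [flatKernel_profile_eq_completed_sq (hc _) (hs _)]
  rw [Finset.prod_mul_distrib, ← Finset.sum_neg_distrib, Real.exp_sum]

/-! ## §2 ★ Chernoff for the stiff block -/

/-- `∫ Πᵢ e^{−tᵢuᵢ²} du = Πᵢ √(π/tᵢ)`. [folklore] -/
theorem integral_prodGauss {ι : Type*} [Fintype ι] (t : ι → ℝ) :
    ∫ u : ι → ℝ, ∏ i, Real.exp (-(t i * u i ^ 2)) = ∏ i, Real.sqrt (π / t i) := by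
  have h := integral_fintype_prod_volume_eq_prod (𝕜 := ℝ) (E := fun _ : ι => ℝ) (fun i (v : ℝ) => Real.exp (-(t i * v ^ 2)))
  rw [h]
  refine Finset.prod_congr rfl fun i _ => ?_
  have := integral_gaussian (t i)
  simp only [neg_mul] at this
  exact this

/-- ★ **CHERNOFF TAIL OF THE PRODUCT GAUSSIAN**: for `sᵢ > 0`, weights `wᵢ` and `θ > 0` with `θwᵢ ≤ sᵢ/2`:
`∫ 𝟙{Σwᵢuᵢ² > ρ}(u)·Πᵢe^{−sᵢuᵢ²} du ≤ (√2)^{|ι|}·e^{−θρ}·Πᵢ√(π/sᵢ)`. [folklore] -/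
theorem integral_indicator_prodGauss_le {ι : Type*} [Fintype ι] {s w : ι → ℝ} (hs : ∀ i, 0 < s i) {θ : ℝ} (hθ : 0 < θ)
    (hθw : ∀ i, θ * w i ≤ s i / 2) (ρ : ℝ) :
    ∫ u : ι → ℝ, {u : ι → ℝ | ρ < ∑ i, w i * u i ^ 2}.indicator (fun _ => (1 : ℝ)) u * ∏ i, Real.exp (-(s i * u i ^ 2)) ≤
      Real.sqrt 2 ^ Fintype.card ι * Real.exp (-(θ * ρ)) * ∏ i, Real.sqrt (π / s i) := by
  -- pointwise: `𝟙{Σwu² > ρ} ≤ e^{θ(Σwu² − ρ)}`, so the integrand is `≤ e^{−θρ}·Π e^{−(sᵢ−θwᵢ)uᵢ²}`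
  have hpt : ∀ u : ι → ℝ, {u : ι → ℝ | ρ < ∑ i, w i * u i ^ 2}.indicator (fun _ => (1 : ℝ)) u * ∏ i, Real.exp (-(s i * u i ^ 2)) ≤
      Real.exp (-(θ * ρ)) * ∏ i, Real.exp (-((s i - θ * w i) * u i ^ 2)) := fun u => by
    have hprod : Real.exp (-(θ * ρ)) * ∏ i, Real.exp (-((s i - θ * w i) * u i ^ 2)) =
        Real.exp (θ * (∑ i, w i * u i ^ 2 - ρ)) * ∏ i, Real.exp (-(s i * u i ^ 2)) := by
      rw [← Real.exp_sum, ← Real.exp_sum, ← Real.exp_add, ← Real.exp_add]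
      congr 1
      rw [mul_sub, Finset.mul_sum]
      have : ∑ i, -((s i - θ * w i) * u i ^ 2) = ∑ i, (-(s i * u i ^ 2) + θ * (w i * u i ^ 2)) := Finset.sum_congr rfl fun i _ => by ring
      rw [this, Finset.sum_add_distrib]; ring
    rw [hprod]
    have hP0 : 0 ≤ ∏ i, Real.exp (-(s i * u i ^ 2)) := Finset.prod_nonneg fun i _ => (Real.exp_pos _).le
    refine mul_le_mul_of_nonneg_right ?_ hP0
    by_cases hu : u ∈ {u : ι → ℝ | ρ < ∑ i, w i * u i ^ 2}
    · rw [Set.indicator_of_mem hu]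
      exact Real.one_le_exp_iff.mpr (mul_nonneg hθ.le (by have : ρ < ∑ i, w i * u i ^ 2 := hu; linarith))
    · rw [Set.indicator_of_notMem hu]; exact (Real.exp_pos _).le
  -- integrability of the majorant (a product Gaussian with positive rates)
  have ht : ∀ i, 0 < s i - θ * w i := fun i => by linarith [hθw i, hs i]
  have hmaj_int : Integrable (fun u : ι → ℝ => Real.exp (-(θ * ρ)) * ∏ i, Real.exp (-((s i - θ * w i) * u i ^ 2))) := by
    refine Integrable.const_mul ?_ _
    have hfi : ∀ i, Integrable (fun v : ℝ => Real.exp (-((s i - θ * w i) * v ^ 2))) (volume : Measure ℝ) := fun i => by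
      have h := integrable_exp_neg_mul_sq (ht i)
      refine h.congr (ae_of_all _ fun v => ?_)
      show Real.exp (-(s i - θ * w i) * v ^ 2) = Real.exp (-((s i - θ * w i) * v ^ 2))
      rw [neg_mul]
    have h := Integrable.fintype_prod (μ := fun _ : ι => (volume : Measure ℝ)) hfi
    exact h
  have hlhs_m : AEStronglyMeasurable (fun u : ι → ℝ => {u : ι → ℝ | ρ < ∑ i, w i * u i ^ 2}.indicator (fun _ => (1 : ℝ)) u * ∏ i, Real.exp (-(s i * u i ^ 2))) volume := by
    refine (((measurable_const.indicator ?_).mul ?_)).aestronglyMeasurable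
    · exact measurableSet_lt measurable_const (Finset.measurable_sum _ fun i _ => (measurable_const.mul ((measurable_pi_apply i).pow_const 2)))
    · exact Finset.measurable_prod _ fun i _ => Real.measurable_exp.comp ((measurable_const.mul ((measurable_pi_apply i).pow_const 2)).neg)
  have hlhs0 : ∀ u : ι → ℝ, 0 ≤ {u : ι → ℝ | ρ < ∑ i, w i * u i ^ 2}.indicator (fun _ => (1 : ℝ)) u * ∏ i, Real.exp (-(s i * u i ^ 2)) := fun u =>
    mul_nonneg (Set.indicator_nonneg (fun _ _ => zero_le_one) _) (Finset.prod_nonneg fun i _ => (Real.exp_pos _).le)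
  have h1 : ∫ u : ι → ℝ, {u : ι → ℝ | ρ < ∑ i, w i * u i ^ 2}.indicator (fun _ => (1 : ℝ)) u * ∏ i, Real.exp (-(s i * u i ^ 2)) ≤
      ∫ u : ι → ℝ, Real.exp (-(θ * ρ)) * ∏ i, Real.exp (-((s i - θ * w i) * u i ^ 2)) :=
    integral_mono_of_nonneg (ae_of_all _ hlhs0) hmaj_int (ae_of_all _ hpt)
  refine h1.trans ?_
  rw [integral_const_mul, integral_prodGauss]
  -- `√(π/(sᵢ − θwᵢ)) ≤ √2·√(π/sᵢ)`
  have h2 : ∏ i, Real.sqrt (π / (s i - θ * w i)) ≤ ∏ i, (Real.sqrt 2 * Real.sqrt (π / s i)) := by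
    refine Finset.prod_le_prod (fun i _ => Real.sqrt_nonneg _) fun i _ => ?_
    rw [← Real.sqrt_mul (by norm_num)]
    refine Real.sqrt_le_sqrt ?_
    rw [div_le_iff₀ (ht i)]
    have hsi : s i ≠ 0 := (hs i).ne'
    have e : 2 * (π / s i) * (s i - θ * w i) = 2 * π - 2 * π * (θ * w i) / s i := by field_simp
    rw [e]
    have h3 : 2 * π * (θ * w i) / s i ≤ π := by
      rw [div_le_iff₀ (hs i)]; nlinarith [hθw i, pi_pos]
    linarith
  rw [Finset.prod_mul_distrib, Finset.prod_const, Finset.card_univ] at h2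
  calc Real.exp (-(θ * ρ)) * ∏ i, Real.sqrt (π / (s i - θ * w i)) ≤ Real.exp (-(θ * ρ)) * (Real.sqrt 2 ^ Fintype.card ι * ∏ i, Real.sqrt (π / s i)) :=
        mul_le_mul_of_nonneg_left h2 (Real.exp_pos _).le
    _ = _ := by ring

/-! ## §3 ★ The gauge block tail -/

section Gauge

variable {Z : Type*} [NormedAddCommGroup Z] [InnerProductSpace ℝ Z] [FiniteDimensional ℝ Z] [MeasurableSpace Z] [BorelSpace Z]

/-- ★ **Gauge block tail**: `∫ 𝟙{ρ' < ‖z‖²}·e^{−‖z‖²/s²} dz ≤ e^{−ρ'/(2s²)}·(2πs²)^{dim Z/2}` (`s > 0`). [folklore] -/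
theorem integral_indicator_gauss_le {s : ℝ} (hs : 0 < s) (ρ' : ℝ) :
    ∫ z : Z, {z : Z | ρ' < ‖z‖ ^ 2}.indicator (fun _ => (1 : ℝ)) z * Real.exp (-(‖z‖ ^ 2 / s ^ 2)) ≤
      Real.exp (-(ρ' / (2 * s ^ 2))) * (π * (2 * s ^ 2)) ^ ((Module.finrank ℝ Z : ℝ) / 2) := by
  have hb : 0 < 1 / (2 * s ^ 2) := by positivity
  have hpt : ∀ z : Z, {z : Z | ρ' < ‖z‖ ^ 2}.indicator (fun _ => (1 : ℝ)) z * Real.exp (-(‖z‖ ^ 2 / s ^ 2)) ≤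
      Real.exp (-(ρ' / (2 * s ^ 2))) * Real.exp (-(1 / (2 * s ^ 2)) * ‖z‖ ^ 2) := fun z => by
    have e : Real.exp (-(ρ' / (2 * s ^ 2))) * Real.exp (-(1 / (2 * s ^ 2)) * ‖z‖ ^ 2) =
        Real.exp ((‖z‖ ^ 2 - ρ') / (2 * s ^ 2)) * Real.exp (-(‖z‖ ^ 2 / s ^ 2)) := by
      rw [← Real.exp_add, ← Real.exp_add]; congr 1; field_simp; ring
    rw [e]
    refine mul_le_mul_of_nonneg_right ?_ (Real.exp_pos _).le
    by_cases hz : z ∈ {z : Z | ρ' < ‖z‖ ^ 2}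
    · rw [Set.indicator_of_mem hz]
      exact Real.one_le_exp_iff.mpr (div_nonneg (by have : ρ' < ‖z‖ ^ 2 := hz; linarith) (by positivity))
    · rw [Set.indicator_of_notMem hz]; exact (Real.exp_pos _).le
  have hgi : Integrable (fun z : Z => Real.exp (-(1 / (2 * s ^ 2)) * ‖z‖ ^ 2)) := by
    refine Integrable.of_integral_ne_zero ?_
    rw [GaussianFourier.integral_rexp_neg_mul_sq_norm hb]; positivity
  have hmaj : Integrable (fun z : Z => Real.exp (-(ρ' / (2 * s ^ 2))) * Real.exp (-(1 / (2 * s ^ 2)) * ‖z‖ ^ 2)) := hgi.const_mul _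
  have h0 : ∀ z : Z, 0 ≤ {z : Z | ρ' < ‖z‖ ^ 2}.indicator (fun _ => (1 : ℝ)) z * Real.exp (-(‖z‖ ^ 2 / s ^ 2)) := fun z =>
    mul_nonneg (Set.indicator_nonneg (fun _ _ => zero_le_one) _) (Real.exp_pos _).le
  refine (integral_mono_of_nonneg (ae_of_all _ h0) hmaj (ae_of_all _ hpt)).trans ?_
  rw [integral_const_mul, GaussianFourier.integral_rexp_neg_mul_sq_norm hb]
  refine le_of_eq ?_
  congr 2
  field_simp

end Gauge

end Summit.QuantumFields.YangMills.Theorems.FemtoTransferGap.TwoLattice.ConstTube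

end
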